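import Literature.Computability.AlgebraicComplexity.TableauEvalLabelMajor
import HarnessLib

/-!
# Label-major evaluation with bit-set states and a polarisation trie (kernel-lean variant)

Topic `Computability/AlgebraicComplexity`; an EXECUTABLE definitions file (kernel-evaluable by
`decide +kernel`, structural recursion only) for the Lean certificate checker of the GCT
multiplicity-obstruction engine (cells `pub-gct` / `pub-gct-max`; honest framing of those cells:
multiplicity-obstruction search for permanent versus determinant at small `(n, m)`; a det-side
certificate is a LOWER bound `r ≤ mult`, i.e. negative census; no claim about VP ≠ VNP or P ≠ NP is
made here or there).

`TableauEval.evalA` (`TableauEvalLabelMajor.lean`) evaluates a column-strict tableau network at a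
point label by label. Two of its ingredients dominate the kernel's work on `det₄`-sized inputs
(`16 × 16` points, `4` boxes per label, alternators on `10` variables): (1) the pruned trie
`buildPTrie` evaluates the symmetric-tensor entry `symEntry P w` (a sum of `#terms` permanents of
size `m`) at EVERY word `w ∈ [0,V)^m` — `10⁴ × 24 × 4!` products for a `det₄` point; (2) the states of
the walk are lists of lists, re-keyed (`keyOf`) and re-mapped at every column. This file computes
the SAME number with (1′) the trie built by iterated POLARISATION of the point — the child `v` of the
trie of `P` is the trie of `∂_v P` (on a sum of products of linear forms: drop one form, multiply by
its `v`-coefficient; Laplace expansion of the permanent along a column), so only prefixes of live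
words are ever visited — and (2′) states carried as ONE natural number (bit `i·V + v` ⇔ variable `v`
of column `i` unused; the kernel's GMP arithmetic does the bookkeeping), the walk of a label
touching only the columns that carry it. Correctness (`evalB = evalC` for column-strict networks
passing the structural check, points whose terms have `m` forms): companion proofs file. Elementary
[folklore] bookkeeping around [DorflerIkenmeyerPanova2020, §5].

## References
* [DorflerIkenmeyerPanova2020] J. Dörfler, C. Ikenmeyer, G. Panova, *On geometric complexity
  theory: multiplicity obstructions are stronger than occurrence obstructions*, SIAM J. Appl.
  Algebra Geom. 4 (2020) = arXiv:1901.04576, §5.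
-/

namespace Literature.Computability.AlgebraicComplexity

namespace TableauEval

/-! ## §1 The polarisation trie -/

section Polar

variable {R : Type*} [CommRing R] [DecidableEq R]

/-- **Polar derivative `∂_v` of a sum of products of linear forms**, as a sum of products with one
form fewer: the term `c · ℓ₀ ⋯ ℓ_{k-1}` contributes `c ℓ_s[v] · ∏_{s' ≠ s} ℓ_{s'}` for every `s`;
zero coefficients are dropped. [folklore] -/
def Point.polar (P : Point R) (v : ℕ) : Point R :=
  ⟨P.terms.flatMap fun t =>
    (List.range t.2.length).filterMap fun s =>
      if t.1 * (t.2.getD s []).getD v 0 = 0 then none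
      else some (t.1 * (t.2.getD s []).getD v 0, t.2.eraseIdx s)⟩

/-- The sum of the coefficients (the value of a point none of whose terms has a form left).
[folklore] -/
def Point.const (P : Point R) : R := (P.terms.map fun t => t.1).sum

/-- **The polarisation trie** of depth `k` over the letters `< V`: leaf = sum of coefficients,
child `v` = trie of `∂_v P`; an exhausted point is the empty trie. For a point all of whose terms
have `k` forms, `find w = symEntry P w` on words of length `k` with letters `< V` (proofs file).
[folklore] -/
def trieD (V : ℕ) : ℕ → Point R → PTrie R
  | 0, P => PTrie.mkLeaf (Point.const P)
  | k + 1, P =>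
    if P.terms.isEmpty then .empty
    else PTrie.mkNode ((List.range V).map fun v => trieD V k (Point.polar P v))

end Polar

/-! ## §2 The walk on bit-set states -/

section Walk

variable {R : Type*} [CommRing R] [DecidableEq R]

/-- The unused variables of column `i` (original alternator variables `vars`) under the state
`key`: those `v ∈ vars` whose bit `i·V + v` is set, in the order of `vars`. [folklore] -/
def unusedVars (V key i : ℕ) (vars : List ℕ) : List ℕ :=
  vars.filter fun v => key.testBit (i * V + v)

/-- The ACTIVE columns of label `u` with their indices: `(i, varsᵢ)` for the columns containing
`u` (for a column-strict network processed in increasing label order: the columns whose topmost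
unused box carries `u`). [folklore] -/
def actPlan (u : ℕ) : List Column → ℕ → List (ℕ × List ℕ)
  | [], _ => []
  | c :: cs, i => if c.labels.elem u then (i, c.vars) :: actPlan u cs (i + 1) else actPlan u cs (i + 1)

/-- The choices of one active column `i`: its `j`-th unused variable `v` (sign `(-1)^j`), provided
the trie has a live child `v`; `cont` walks the remaining active columns from the updated state.
[folklore] -/
def choicesB (V key i : ℕ) (t : PTrie R) (cont : ℕ → PTrie R → List (Bool × R × ℕ)) :
    List ℕ → ℕ → List (Bool × R × ℕ)
  | [], _ => []
  | v :: vs, j =>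
    (if (t.child v).isEmpty then []
      else (cont (key ^^^ 2 ^ (i * V + v)) (t.child v)).map fun r =>
        (xor (decide (j % 2 = 1)) r.1, r.2)) ++
      choicesB V key i t cont vs (j + 1)

/-- **Walk of one label on a bit-set state** along its active columns, descending the trie;
outcomes `(parity, entry of the word, new state)`. [folklore] -/
def walkB (V : ℕ) : List (ℕ × List ℕ) → ℕ → PTrie R → List (Bool × R × ℕ)
  | [], key, t => match t with
    | .leaf a => [(false, a, key)]
    | _ => []
  | (i, vars) :: rest, key, t =>
    choicesB V key i t (fun key' t' => walkB V rest key' t') (unusedVars V key i vars) 0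

/-- The expansion of a layer `[(state, value)]` along label `u`. [folklore] -/
def expandB (cols : List Column) (V : ℕ) (T : PTrie R) (u : ℕ) (L : List (ℕ × R)) :
    List (ℕ × R) :=
  let pl := actPlan u cols 0
  L.flatMap fun e => (walkB V pl e.1 T).map fun r => (r.2.2, smul3 r.1 e.2 r.2.1)

/-- Push a `(state, value)` pair, adding the values when the front state is the same. [folklore] -/
def pushB (a : ℕ × R) : List (ℕ × R) → List (ℕ × R)
  | [] => [a]
  | b :: l => if a.1 == b.1 then (a.1, a.2 + b.2) :: l else a :: b :: l

/-- Add up the values of adjacent equal states and drop the states of value `0`. [folklore] -/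
def compressB (l : List (ℕ × R)) : List (ℕ × R) :=
  (l.foldr pushB []).filter fun e => !decide (e.2 = 0)

/-- **One layer**: expand along label `u`, sort by state, add up equal states. [folklore] -/
def stepB (cols : List Column) (V : ℕ) (T : PTrie R) (u : ℕ) (L : List (ℕ × R)) : List (ℕ × R) :=
  let E := expandB cols V T u L
  compressB (msortK (Nat.log2 E.length + 2) E)

/-- All layers along a list of labels. [folklore] -/
def layersB (cols : List Column) (V : ℕ) (T : PTrie R) : List ℕ → List (ℕ × R) → List (ℕ × R)
  | [], L => L
  | u :: us, L => layersB cols V T us (stepB cols V T u L)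

/-- The initial state: every alternator variable of every column unused. [folklore] -/
def initKey (V : ℕ) : List Column → ℕ → ℕ
  | [], _ => 0
  | c :: cs, i => c.vars.foldr (fun v acc => acc ||| 2 ^ (i * V + v)) 0 ||| initKey V cs (i + 1)

/-- Sum of the values of a layer. [folklore] -/
def layerSumB (L : List (ℕ × R)) : R := (L.map fun e => e.2).sum

/-- **Label-major evaluation of the tableau network `N` at the point `P`, bit-set states and
polarisation trie** — equal to `evalC P N` for column-strict networks passing the structural check
and points all of whose terms have `N.perLabel` forms (proofs file). [folklore] -/
def evalB (P : Point R) (N : Network) : R :=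
  layerSumB (layersB N.cols N.varBound (trieD N.varBound N.perLabel P) (List.range N.nlabels)
    [(initKey N.varBound N.cols 0, 1)])

end Walk

/-! ## §3 Sanity values (kernel) -/

/-- On the toy network `1 1 / 2 2` at `2 x₀ x₁` presented as two products, `evalB = evalA = -8`.
[folklore] -/
example :
    let P : Point ℤ := ⟨[(1, [[1, 0], [0, 1]]), (1, [[0, 1], [1, 0]])]⟩
    let N : Network := ⟨2, 2, [⟨[0, 1], [0, 1]⟩, ⟨[0, 1], [0, 1]⟩]⟩
    evalB P N = -8 ∧ evalA P N = -8 := by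
  decide +kernel

/-- The `3 × 3` cross-check of `TableauEvalLabelMajor.lean` in the kernel: `evalB = evalC`
(shape `(5,2,2)`, `d = m = 3`, a `per₃` point, modulo `101`). [folklore] -/
example :
    let g : List (List (ZMod 101)) := [[1, 1, 0, 1, 0, 0, 0, 0, 0], [0, 0, 0, 0, 1, 0, 0, 0, 1],
      [1, 0, 0, 0, 0, 0, 0, 0, 0], [0, 0, 1, 0, 0, 0, 0, 0, 0], [0, 0, 0, 0, 0, 0, 0, 1, 0],
      [0, 0, 0, 0, 0, 0, 1, 0, 0], [0, 0, 0, 0, 0, 1, 0, 0, 0], [0, 0, 0, 0, 1, 0, 0, 0, 0],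
      [0, 0, 0, 0, 0, 0, 0, 0, 0]]
    let P : Point (ZMod 101) := ⟨(permsSign [0, 1, 2]).map fun q =>
      (1, (List.range 3).map fun i => g.map fun row => row.getD (i * 3 + q.2.getD i 0) 0)⟩
    let N : Network := ⟨3, 3, [⟨[0, 1, 2], [0, 1, 2]⟩, ⟨[0, 1, 2], [0, 1, 2]⟩, ⟨[0], [0]⟩,
      ⟨[0], [1]⟩, ⟨[0], [2]⟩]⟩
    evalB P N = evalC P N := by
  decide +kernel

end TableauEval

end Literature.Computability.AlgebraicComplexity
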